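import Literature.Probability.Percolation.KohlerSchindlerTassionRSW
import Literature.Probability.Percolation.PlanarDuality
import Literature.Probability.Percolation.LatticeSymmetry
import Literature.Probability.Percolation.CornerPercolation
import HarnessLib

/-!
# Köhler-Schindler–Tassion-type RSW for periodic measures: the events

Topic `Literature/Probability/Percolation`. This file fixes the vocabulary for a *weak,
constant form* of the Russo–Seymour–Welsh theorem of Köhler-Schindler–Tassion
[KohlerSchindlerTassion2023] (Duke Math. J. 172 (2023), arXiv:2011.04618, Theorem 1 and the
"robustness" Comment 1) for bond measures on `ℤ²` that are invariant only under a *sublattice*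
`kℤ²` of translations together with the dihedral group `D₄` of a centre `(-t/2, -t/2)`, `t ∈ ℕ`
(`t = 0`: a lattice point; `t = 1`: a face centre — the case of the planar dual of a
`kℤ² ⋊ D₄`-invariant measure, relabelled by lower-left corners as in `Crossings.lean`), and
positively associated. All rectangles of the paper are therefore taken symmetric about that
centre: `R_t(m, n) = [-m - t, m] × [-n - t, n]`.

## Contents

* `rect a b c d` — the lattice rectangle `[a, b] × [c, d]`; `lrRect`, `tbRect` its open
  left–right / top–bottom crossings (`openCrossing` of `Crossings.lean`).
* `crossing t m n` — the horizontal crossing `𝓒(m, n)` of `R_t(m, n)` (for `t = 0` this is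
  `KST2023.crossing m n`, `crossing_zero_eq`).
* `arm t a n` — the arm event: a connection inside `R_t(n + a, n)` from the upper target
  `[-a - t, a] × {n}` to the lower target `[-a - t, a] × {-n - t}` (paper: `a = αn`, `α = 1/64`).
* `bridge t b n` — the bridge event: a connection inside `R_t(n + b, n)` from the left part
  (left side, and the top/bottom boundary points with `x₀ ≤ -b - t`) to the right part
  (paper: `b = βn`, `β = 1/12`).
* `MPathAt t b m ω z` — `z` lies on an open `m`-path: `z` is joined inside
  `H = R_t(m + b, m)` to the upper target `[-b - t, b] × {m}` and to the lower target.
* `quasi t w n b m` — the quasi-crossing `𝓠(n, m)`: inside `R_t(n + w, n)` (paper: `w = 3βn`)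
  some vertex of an open `m`-path is joined to the left side and some vertex of an open
  `m`-path is joined to the right side.
* `flipEquiv t` — the reflection `x ↦ (-t - x₀, x₁)` in the vertical line `x₀ = -t/2`;
  `Admissible k t μ` — the standing hypotheses: invariance under the translations of `kℤ²`,
  under the transposition `(x₀, x₁) ↦ (x₁, x₀)` and under `flipEquiv t` (these generate
  `kℤ² ⋊ D₄` about `(-t/2, -t/2)`), and positive association.
* Elementary API: membership lemmas, monotonicity of the events in their boxes, measurability
  (via `measurableSet_openCrossing_of_countable` of `CornerPercolation.lean`), the events are
  increasing. Theorems consuming `Admissible k t μ` assume `1 ≤ k` (for `k = 0` the translation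
  hypothesis is void).

Design: walks rather than self-avoiding paths throughout (the paper's "paths" are simple; every
statement used below holds verbatim for walks, and `openConnIn` is reachability); integer
parameters `a, b, w` instead of `αn, βn, 3βn` (the theorem is applied along scales where these
are integers and multiples of `k`, so no rounding is ever needed).

## References

* [KohlerSchindlerTassion2023] L. Köhler-Schindler, V. Tassion, *Crossing probabilities for
  planar percolation*, Duke Math. J. 172 (2023) 809–838, §1 (notation), §3–§5.
* [GrimmettPercolation1999] G. Grimmett, *Percolation*, 2nd ed. (1999), §11.7.
-/

namespace Literature.Probability.Percolation

open _root_.MeasureTheory LatticeModels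

noncomputable section

namespace KSTPeriodic

/-! ### Rectangles and their crossings -/

/-- The lattice rectangle `[a, b] × [c, d] ∩ ℤ²`. [cite: KohlerSchindlerTassion2023, §1 Rectangle crossings] -/
def rect (a b c d : ℤ) : Set (Site 2) := {x : Site 2 | a ≤ x 0 ∧ x 0 ≤ b ∧ c ≤ x 1 ∧ x 1 ≤ d}

/-- Membership in `rect`. [folklore] -/
@[simp] theorem mem_rect {a b c d : ℤ} {x : Site 2} :
    x ∈ rect a b c d ↔ a ≤ x 0 ∧ x 0 ≤ b ∧ c ≤ x 1 ∧ x 1 ≤ d := Iff.rfl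

/-- `rect` is monotone in its bounds. [folklore] -/
theorem rect_mono {a b c d a' b' c' d' : ℤ} (ha : a' ≤ a) (hb : b ≤ b') (hc : c' ≤ c) (hd : d ≤ d') :
    rect a b c d ⊆ rect a' b' c' d' := fun _ hx => ⟨ha.trans hx.1, hx.2.1.trans hb, hc.trans hx.2.2.1, hx.2.2.2.trans hd⟩

/-- The open left–right crossing of `[a, b] × [c, d]`: an open path inside the rectangle from its
left column `x₀ = a` to its right column `x₀ = b`. [cite: KohlerSchindlerTassion2023, §1 Rectangle crossings] -/
def lrRect (a b c d : ℤ) : Set (BondConfig (Site 2)) :=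
  openCrossing (rect a b c d) {x | x ∈ rect a b c d ∧ x 0 = a} {x | x ∈ rect a b c d ∧ x 0 = b}

/-- The open top–bottom crossing of `[a, b] × [c, d]`: an open path inside the rectangle from its
bottom row `x₁ = c` to its top row `x₁ = d`. [cite: KohlerSchindlerTassion2023, §1 Rectangle crossings] -/
def tbRect (a b c d : ℤ) : Set (BondConfig (Site 2)) :=
  openCrossing (rect a b c d) {x | x ∈ rect a b c d ∧ x 1 = c} {x | x ∈ rect a b c d ∧ x 1 = d}

/-- The horizontal crossing event `𝓒(m, n)` of the rectangle `R_t(m, n) = [-m - t, m] × [-n - t, n]`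
symmetric about `(-t/2, -t/2)`. [cite: KohlerSchindlerTassion2023, §1 Rectangle crossings] -/
def crossing (t m n : ℕ) : Set (BondConfig (Site 2)) :=
  lrRect (-(m : ℤ) - t) m (-(n : ℤ) - t) n

/-- For `t = 0` the symmetric rectangle is the paper's `R(m, n)` and `crossing 0 m n` is
`KST2023.crossing m n`. [cite: KohlerSchindlerTassion2023, §1 Rectangle crossings] -/
theorem crossing_zero_eq (m n : ℕ) : crossing 0 m n = KST2023.crossing m n := by
  have hbox : rect (-(m : ℤ)) m (-(n : ℤ)) n = KST2023.box m n := by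
    ext x; simp only [mem_rect, KST2023.mem_box, abs_le]; tauto
  simp only [crossing, Nat.cast_zero, sub_zero, lrRect, hbox]
  rfl

/-! ### Arms, bridges, m-paths and quasi-crossings -/

/-- The upper target `[-a - t, a] × {n}`. [cite: KohlerSchindlerTassion2023, §1 Arms and bridges] -/
def upperTarget (t a : ℕ) (n : ℤ) : Set (Site 2) := {x | -(a : ℤ) - t ≤ x 0 ∧ x 0 ≤ a ∧ x 1 = n}

/-- Membership in `upperTarget`. [folklore] -/
@[simp] theorem mem_upperTarget {t a : ℕ} {n : ℤ} {x : Site 2} :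
    x ∈ upperTarget t a n ↔ -(a : ℤ) - t ≤ x 0 ∧ x 0 ≤ a ∧ x 1 = n := Iff.rfl

/-- The arm event `𝓐(n)` with target half-width `a` (paper: `a = αn`, `α = 1/64`): inside
`R_t(n + a, n)` the upper target `[-a - t, a] × {n}` is joined to the lower target
`[-a - t, a] × {-n - t}`. [cite: KohlerSchindlerTassion2023, §1 Arms and bridges] -/
def arm (t a n : ℕ) : Set (BondConfig (Site 2)) :=
  openCrossing (rect (-((n : ℤ) + a) - t) (n + a) (-(n : ℤ) - t) n)
    (upperTarget t a n) (upperTarget t a (-(n : ℤ) - t))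

/-- The left part of the boundary of `R_t(n + b, n)`: its left column, and the points of its top
and bottom rows with `x₀ ≤ -b - t`. [cite: KohlerSchindlerTassion2023, §1 Arms and bridges] -/
def leftPart (t b n : ℕ) : Set (Site 2) :=
  {x | x ∈ rect (-((n : ℤ) + b) - t) (n + b) (-(n : ℤ) - t) n ∧
    (x 0 = -((n : ℤ) + b) - t ∨ ((x 1 = n ∨ x 1 = -(n : ℤ) - t) ∧ x 0 ≤ -(b : ℤ) - t))}

/-- The right part of the boundary of `R_t(n + b, n)` (mirror image of `leftPart` in
`x₀ = -t/2`). [cite: KohlerSchindlerTassion2023, §1 Arms and bridges] -/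
def rightPart (t b n : ℕ) : Set (Site 2) :=
  {x | x ∈ rect (-((n : ℤ) + b) - t) (n + b) (-(n : ℤ) - t) n ∧
    (x 0 = (n : ℤ) + b ∨ ((x 1 = n ∨ x 1 = -(n : ℤ) - t) ∧ (b : ℤ) ≤ x 0))}

/-- The bridge event `𝓑(n)` with margin `b` (paper: `b = βn`, `β = 1/12`): inside `R_t(n + b, n)`
the left part of the boundary is joined to the right part. [cite: KohlerSchindlerTassion2023, §1 Arms and bridges] -/
def bridge (t b n : ℕ) : Set (BondConfig (Site 2)) :=
  openCrossing (rect (-((n : ℤ) + b) - t) (n + b) (-(n : ℤ) - t) n) (leftPart t b n) (rightPart t b n)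

/-- The region `H = R_t(m + b, m)` of `m`-paths. [cite: KohlerSchindlerTassion2023, §4.1] -/
def mRegion (t b m : ℕ) : Set (Site 2) := rect (-((m : ℤ) + b) - t) (m + b) (-(m : ℤ) - t) m

/-- `z` lies on an open `m`-path (margin `b`; paper `b = βm`): `z` is joined inside
`H = R_t(m + b, m)` both to the upper target `[-b - t, b] × {m}` and to the lower target
`[-b - t, b] × {-m - t}` (equivalently: some open walk in `H` from the upper to the lower target
passes through `z`). [cite: KohlerSchindlerTassion2023, §4.1] -/
def MPathAt (t b m : ℕ) (ω : BondConfig (Site 2)) (z : Site 2) : Prop :=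
  (∃ u ∈ upperTarget t b m, ω ∈ openConnIn (mRegion t b m) z u) ∧
    (∃ v ∈ upperTarget t b (-(m : ℤ) - t), ω ∈ openConnIn (mRegion t b m) z v)

/-- Left half of the quasi-crossing: inside `R_t(n + w, n)` some vertex of an open `m`-path is
joined to the left column. [cite: KohlerSchindlerTassion2023, §4.1] -/
def quasiLeft (t w n b m : ℕ) : Set (BondConfig (Site 2)) :=
  {ω | ∃ z, MPathAt t b m ω z ∧ ∃ l, l ∈ rect (-((n : ℤ) + w) - t) (n + w) (-(n : ℤ) - t) n ∧
    l 0 = -((n : ℤ) + w) - t ∧ ω ∈ openConnIn (rect (-((n : ℤ) + w) - t) (n + w) (-(n : ℤ) - t) n) z l}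

/-- Right half of the quasi-crossing: inside `R_t(n + w, n)` some vertex of an open `m`-path is
joined to the right column. [cite: KohlerSchindlerTassion2023, §4.1] -/
def quasiRight (t w n b m : ℕ) : Set (BondConfig (Site 2)) :=
  {ω | ∃ z, MPathAt t b m ω z ∧ ∃ r, r ∈ rect (-((n : ℤ) + w) - t) (n + w) (-(n : ℤ) - t) n ∧
    r 0 = (n : ℤ) + w ∧ ω ∈ openConnIn (rect (-((n : ℤ) + w) - t) (n + w) (-(n : ℤ) - t) n) z r}

/-- The quasi-crossing `𝓠(n, m)` (big margin `w`, paper `w = 3βn`; small margin `b`, paper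
`b = βm`): an open `m`-path joined to the left side of `R_t(n + w, n)` and an open `m`-path joined
to its right side. [cite: KohlerSchindlerTassion2023, §4.1] -/
def quasi (t w n b m : ℕ) : Set (BondConfig (Site 2)) := quasiLeft t w n b m ∩ quasiRight t w n b m

/-! ### The symmetry class -/

/-- The reflection of `ℤ²` in the vertical line `x₀ = -t/2`: `x ↦ (-t - x₀, x₁)` (an involution).
[cite: KohlerSchindlerTassion2023, §1 Symmetries] -/
def flipEquiv (t : ℕ) : Site 2 ≃ Site 2 where
  toFun x := ![-(t : ℤ) - x 0, x 1]
  invFun x := ![-(t : ℤ) - x 0, x 1]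
  left_inv x := by ext i; fin_cases i <;> simp
  right_inv x := by ext i; fin_cases i <;> simp

/-- `flipEquiv` in coordinates. [folklore] -/
@[simp] theorem flipEquiv_apply (t : ℕ) (x : Site 2) : flipEquiv t x = ![-(t : ℤ) - x 0, x 1] := rfl

/-- The transposition `(x₀, x₁) ↦ (x₁, x₀)` as a bijection of `ℤ²` (the tree's `transposeIso`).
[cite: KohlerSchindlerTassion2023, §1 Symmetries] -/
def transposeEquiv : Site 2 ≃ Site 2 := (transposeIso).toEquiv

/-- `transposeEquiv` in coordinates. [folklore] -/
@[simp] theorem transposeEquiv_apply (x : Site 2) : transposeEquiv x = ![x 1, x 0] :=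
  transposeIso_apply x

/-- The standing hypotheses of the periodic RSW theorem for a measure `μ` on bond configurations
of `ℤ²`: invariance under the translations of `kℤ²`, under the transposition and under the
reflection in `x₀ = -t/2` (together: under `kℤ² ⋊ D₄` with the dihedral group centred at
`(-t/2, -t/2)`), and positive association. For `k = 1, t = 0` this is the setting of
[KohlerSchindlerTassion2023, Theorem 1] (`KST2023.IsInvariant` + `IsPositivelyAssociated`).
[cite: KohlerSchindlerTassion2023, §1 and Comment 1] -/
structure Admissible (k t : ℕ) (μ : Measure (BondConfig (Site 2))) : Prop where
  /-- invariance under the translations of `kℤ²` -/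
  shift_inv : ∀ v : Site 2, μ.map (KST2023.act (Site.shift ((k : ℤ) • v))) = μ
  /-- invariance under `(x₀, x₁) ↦ (x₁, x₀)` -/
  transpose_inv : μ.map (KST2023.act transposeEquiv) = μ
  /-- invariance under `x ↦ (-t - x₀, x₁)` -/
  flip_inv : μ.map (KST2023.act (flipEquiv t)) = μ
  /-- positive association (FKG) -/
  posAssoc : IsPositivelyAssociated μ

/-! ### Elementary API -/

/-- Rectangle crossings are increasing. [cite: KohlerSchindlerTassion2023, §1 Positive association] -/
theorem isUpperSet_lrRect (a b c d : ℤ) : IsUpperSet (lrRect a b c d) := isUpperSet_openCrossing _ _ _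

/-- Rectangle crossings are increasing. [cite: KohlerSchindlerTassion2023, §1 Positive association] -/
theorem isUpperSet_tbRect (a b c d : ℤ) : IsUpperSet (tbRect a b c d) := isUpperSet_openCrossing _ _ _

/-- Arm events are increasing. [cite: KohlerSchindlerTassion2023, §1 Positive association] -/
theorem isUpperSet_arm (t a n : ℕ) : IsUpperSet (arm t a n) := isUpperSet_openCrossing _ _ _

/-- Bridge events are increasing. [cite: KohlerSchindlerTassion2023, §1 Positive association] -/
theorem isUpperSet_bridge (t b n : ℕ) : IsUpperSet (bridge t b n) := isUpperSet_openCrossing _ _ _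

/-- Being on an open `m`-path is monotone in the configuration. [folklore] -/
theorem MPathAt.mono {t b m : ℕ} {ω ω' : BondConfig (Site 2)} (h : ω ≤ ω') {z : Site 2}
    (hz : MPathAt t b m ω z) : MPathAt t b m ω' z :=
  ⟨hz.1.imp fun _ hu => ⟨hu.1, isUpperSet_openConnIn _ _ _ h hu.2⟩,
    hz.2.imp fun _ hv => ⟨hv.1, isUpperSet_openConnIn _ _ _ h hv.2⟩⟩

/-- Quasi-crossings are increasing. [cite: KohlerSchindlerTassion2023, §4.4 (the event is increasing)] -/
theorem isUpperSet_quasiLeft (t w n b m : ℕ) : IsUpperSet (quasiLeft t w n b m) := by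
  rintro ω ω' h ⟨z, hz, l, hl, hl0, hc⟩
  exact ⟨z, hz.mono h, l, hl, hl0, isUpperSet_openConnIn _ _ _ h hc⟩

/-- Quasi-crossings are increasing. [cite: KohlerSchindlerTassion2023, §4.4 (the event is increasing)] -/
theorem isUpperSet_quasiRight (t w n b m : ℕ) : IsUpperSet (quasiRight t w n b m) := by
  rintro ω ω' h ⟨z, hz, r, hr, hr0, hc⟩
  exact ⟨z, hz.mono h, r, hr, hr0, isUpperSet_openConnIn _ _ _ h hc⟩

/-- Quasi-crossings are increasing. [cite: KohlerSchindlerTassion2023, §4.4 (the event is increasing)] -/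
theorem isUpperSet_quasi (t w n b m : ℕ) : IsUpperSet (quasi t w n b m) :=
  (isUpperSet_quasiLeft t w n b m).inter (isUpperSet_quasiRight t w n b m)

/-- Open crossing events of `ℤ²` are measurable (countable vertex type). [folklore] -/
theorem measurableSet_lrRect (a b c d : ℤ) : MeasurableSet (lrRect a b c d) :=
  measurableSet_openCrossing_of_countable _ _ _

/-- Open crossing events of `ℤ²` are measurable. [folklore] -/
theorem measurableSet_tbRect (a b c d : ℤ) : MeasurableSet (tbRect a b c d) :=
  measurableSet_openCrossing_of_countable _ _ _

/-- Arm events are measurable. [folklore] -/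
theorem measurableSet_arm (t a n : ℕ) : MeasurableSet (arm t a n) :=
  measurableSet_openCrossing_of_countable _ _ _

/-- Bridge events are measurable. [folklore] -/
theorem measurableSet_bridge (t b n : ℕ) : MeasurableSet (bridge t b n) :=
  measurableSet_openCrossing_of_countable _ _ _

end KSTPeriodic

end

end Literature.Probability.Percolation
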